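import Summits.AtomisticToContinuum.Crystallization.Theorems.PerronTransitivityNoFractionalGainStubMergeReduction
import Summits.AtomisticToContinuum.Crystallization.Theorems.PerronTransitivityNoFractionalGainStubCoreHeight
import Summits.AtomisticToContinuum.Crystallization.Theorems.PerronTransitivityNoFractionalGainHeartHcpCase

/-!
# Crux `PerronTransitivity.NoFractionalGain` (stmt-AtomisticToContinuum-15098), line `merge-perron`:
# the separated form of K* (skeleton rev. 4)

K* (`NoFractionalGain`): for every injective finite `x : Fin N → ℝ³` and every `c ≥ 0`,
`2E*·∑cᵢ² ≤ ∑_{i≠j} cᵢcⱼV_LJ(dist xᵢ xⱼ)`, `E* = ⨅_Q e_LJ(Q)`.  This file records, as theorems, what the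
line `merge-perron` contributes to the crux and what its rev. 4 skeleton registers:

* `copositiveBound_iff_separated_of_coreHeight` — at ANY level `E` whose doubled negative the core
  dominates on `(0, δ]` (`−2E ≤ V_LJ(r)` for `0 < r ≤ δ`), the copositive inequality with level `E` holds on
  all injective finite configurations iff it holds on the `δ`-SEPARATED ones (merge reduction
  `mergeReduction_of_coreHeight`, p163115; the other direction is restriction);
* `noFractionalGain_iff_sep73` — hence K* ⇔ K* on `73/100`-separated configurations (the tree's core
  height `stub_coreHeight`, p158162): the registered open stub `stub_separatedNoFractionalGain` of
  `Cruxes/NoFractionalGain/Lines/merge_perron.lean` (rev. 4) is EQUIVALENT to the crux, neither weaker nor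
  (unlike rev. 3's explicit-constant heart, which is `K* ∧ hcp-least`, p163964) stronger;
* `quadForm_abs_le_of_kernel_nonpos`, `copositive_iff_allReal_of_kernel_nonpos`,
  `lj_copositive_iff_allReal_of_separated` — on `2^{-1/6}`-separated configurations (all pairs attractive,
  `V_LJ ≤ 0`) the inequality for `c ≥ 0` is equivalent to the inequality for ALL real `c`
  (`|c|` does at least as well as `c`): there K* is the Perron-root bound `λ_max[−V_ij] ≤ 2|E*|`, a
  statement about a symmetric matrix with non-negative entries, which is the form every landed certificate
  (`stub_certificate`, p159684) addresses.

All `[folklore]`.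
-/

noncomputable section

namespace Summit.AtomisticToContinuum.Crystallization.Theorems.PerronTransitivity.NoFractionalGain

open Literature.MathematicalPhysics.StatisticalMechanics
open scoped BigOperators

/-! ## Copositive = positive semidefinite for attractive kernels -/

section General

variable {ι : Type*} [Fintype ι] [DecidableEq ι]

/-- For a kernel that is non-positive off the diagonal, replacing the weights by their absolute values
can only DEcrease the off-diagonal quadratic form: `∑_{i≠j} |cᵢ||cⱼ|V i j ≤ ∑_{i≠j} cᵢcⱼV i j`.
[folklore] -/
theorem quadForm_abs_le_of_kernel_nonpos (V : ι → ι → ℝ) (hV : ∀ i j, i ≠ j → V i j ≤ 0)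
    (c : ι → ℝ) :
    ∑ i, ∑ j ∈ Finset.univ.erase i, |c i| * |c j| * V i j ≤
      ∑ i, ∑ j ∈ Finset.univ.erase i, c i * c j * V i j := by
  refine Finset.sum_le_sum fun i _ => Finset.sum_le_sum fun j hj => ?_
  have hij : i ≠ j := (Finset.ne_of_mem_erase hj).symm
  have h1 : c i * c j ≤ |c i| * |c j| := by
    rw [← abs_mul]
    exact le_abs_self _
  exact mul_le_mul_of_nonpos_right h1 (hV i j hij)

/-- **Copositive ⇔ positive semidefinite for attractive kernels.**  If `V i j ≤ 0` off the diagonal,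
the bound `L·∑cᵢ² ≤ ∑_{i≠j} cᵢcⱼ V i j` holds for all `c ≥ 0` iff it holds for all real `c`. [folklore] -/
theorem copositive_iff_allReal_of_kernel_nonpos (V : ι → ι → ℝ) (hV : ∀ i j, i ≠ j → V i j ≤ 0)
    (L : ℝ) :
    (∀ c : ι → ℝ, (∀ i, 0 ≤ c i) → L * ∑ i, c i ^ 2 ≤ ∑ i, ∑ j ∈ Finset.univ.erase i, c i * c j * V i j) ↔
      ∀ c : ι → ℝ, L * ∑ i, c i ^ 2 ≤ ∑ i, ∑ j ∈ Finset.univ.erase i, c i * c j * V i j := by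
  refine ⟨fun h c => ?_, fun h c _ => h c⟩
  have h1 := h (fun i => |c i|) fun i => abs_nonneg _
  have h2 : ∑ i, |c i| ^ 2 = ∑ i, c i ^ 2 := Finset.sum_congr rfl fun i _ => sq_abs (c i)
  rw [h2] at h1
  exact h1.trans (quadForm_abs_le_of_kernel_nonpos V hV c)

end General

/-- **On `2^{-1/6}`-separated configurations the Lennard-Jones copositive bound is a bound for all real
weights** (`dist⁶ ≥ 1/2` makes every pair attractive, `lennardJones_nonpos_of_half_le_pow_six`): for any
level `L`, `L·∑cᵢ² ≤ ∑_{i≠j} cᵢcⱼV_LJ(dist xᵢ xⱼ)` for all `c ≥ 0` iff for all real `c`. [folklore] -/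
theorem lj_copositive_iff_allReal_of_separated {N : ℕ} (x : Fin N → EuclideanSpace ℝ (Fin 3))
    (hsep : ∀ i j, i ≠ j → (1 : ℝ) / 2 ≤ dist (x i) (x j) ^ 6) (L : ℝ) :
    (∀ c : Fin N → ℝ, (∀ i, 0 ≤ c i) →
        L * ∑ i, c i ^ 2 ≤ ∑ i, ∑ j ∈ Finset.univ.erase i, c i * c j * lennardJones (dist (x i) (x j))) ↔
      ∀ c : Fin N → ℝ,
        L * ∑ i, c i ^ 2 ≤ ∑ i, ∑ j ∈ Finset.univ.erase i, c i * c j * lennardJones (dist (x i) (x j)) :=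
  copositive_iff_allReal_of_kernel_nonpos (fun i j => lennardJones (dist (x i) (x j)))
    (fun i j hij => lennardJones_nonpos_of_half_le_pow_six (hsep i j hij)) L

/-! ## The copositive bound reduces to separated configurations -/

/-- **Merge reduction as an equivalence, at any admissible level.**  If `−2E ≤ V_LJ(r)` for
`0 < r ≤ δ`, then `2E·∑cᵢ² ≤ ∑_{i≠j} cᵢcⱼV_LJ(dist xᵢ xⱼ)` holds for every injective finite `x` and every
`c ≥ 0` iff it holds for every `δ`-separated injective finite `x` and every `c ≥ 0`
(`mergeReduction_of_coreHeight`: merging a close pair onto its better-bound partner never increases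
`∑_{i≠j} cᵢcⱼV − 2E|c|²`). [folklore] -/
theorem copositiveBound_iff_separated_of_coreHeight (E δ : ℝ)
    (hcore : ∀ r : ℝ, 0 < r → r ≤ δ → -2 * E ≤ lennardJones r) :
    (∀ (N : ℕ) (x : Fin N → EuclideanSpace ℝ (Fin 3)), Function.Injective x →
      ∀ c : Fin N → ℝ, (∀ i, 0 ≤ c i) →
        2 * E * ∑ i, c i ^ 2 ≤ ∑ i, ∑ j ∈ Finset.univ.erase i, c i * c j * lennardJones (dist (x i) (x j))) ↔
    ∀ (N : ℕ) (x : Fin N → EuclideanSpace ℝ (Fin 3)), Function.Injective x →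
      (∀ i j, i ≠ j → δ ≤ dist (x i) (x j)) →
      ∀ c : Fin N → ℝ, (∀ i, 0 ≤ c i) →
        2 * E * ∑ i, c i ^ 2 ≤ ∑ i, ∑ j ∈ Finset.univ.erase i, c i * c j * lennardJones (dist (x i) (x j)) := by
  refine ⟨fun h N x hx _ c hc => h N x hx c hc, fun h N x hx c hc => ?_⟩
  obtain ⟨N', x', c', hx', hsep', hc', hF⟩ := mergeReduction_of_coreHeight E δ hcore x hx c hc
  have h' := h N' x' hx' hsep' c' hc'
  linarith

/-- **K* ⇔ K* on `73/100`-separated configurations** (the content of line `merge-perron`; its rev. 4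
open stub `stub_separatedNoFractionalGain` is the right-hand side, so the stub is EQUIVALENT to the crux
`PerronTransitivity.NoFractionalGain`, stmt-AtomisticToContinuum-15098).  The core height
`−2E* ≤ V_LJ(r)` on `(0, 73/100]` is the landed `stub_coreHeight`. [folklore] -/
theorem noFractionalGain_iff_sep73 :
    Summit.AtomisticToContinuum.Crystallization.Theses.PerronTransitivity.NoFractionalGain ↔
    ∀ (N : ℕ) (x : Fin N → EuclideanSpace ℝ (Fin 3)), Function.Injective x →
      (∀ i j, i ≠ j → (73 : ℝ) / 100 ≤ dist (x i) (x j)) →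
      ∀ c : Fin N → ℝ, (∀ i, 0 ≤ c i) →
        2 * (⨅ Q : PeriodicConfiguration 3, Q.energyPerParticle lennardJones) * ∑ i, c i ^ 2 ≤
          ∑ i, ∑ j ∈ Finset.univ.erase i, c i * c j * lennardJones (dist (x i) (x j)) := by
  unfold Summit.AtomisticToContinuum.Crystallization.Theses.PerronTransitivity.NoFractionalGain
  exact copositiveBound_iff_separated_of_coreHeight _ (73 / 100) stub_coreHeight

/-- **The separated form, spectral reading.**  K* is equivalent to: for every `73/100`-separated
injective finite `x` and `c ≥ 0` the copositive inequality holds; and on the `2^{-1/6}`-separated ones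
(`dist⁶ ≥ 1/2`, a sub-class since `0.73⁶ < 1/2`) this is the same as the inequality for ALL real `c`, i.e.
`λ_min[V_LJ(dist xᵢ xⱼ)]_{i≠j} ≥ 2E*`.  Recorded as the implication K* ⇒ (all-real form on
`2^{-1/6}`-separated sets). [folklore] -/
theorem allReal_on_separated_of_noFractionalGain
    (hK : Summit.AtomisticToContinuum.Crystallization.Theses.PerronTransitivity.NoFractionalGain)
    {N : ℕ} (x : Fin N → EuclideanSpace ℝ (Fin 3)) (hx : Function.Injective x)
    (hsep : ∀ i j, i ≠ j → (1 : ℝ) / 2 ≤ dist (x i) (x j) ^ 6) (c : Fin N → ℝ) :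
    2 * (⨅ Q : PeriodicConfiguration 3, Q.energyPerParticle lennardJones) * ∑ i, c i ^ 2 ≤
      ∑ i, ∑ j ∈ Finset.univ.erase i, c i * c j * lennardJones (dist (x i) (x j)) :=
  (lj_copositive_iff_allReal_of_separated x hsep _).1 (fun c hc => hK N x hx c hc) c

end Summit.AtomisticToContinuum.Crystallization.Theorems.PerronTransitivity.NoFractionalGain

end
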